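/-
Origin: expansion seat `literature-prover-pub-hodgecm-cf-gaoullmo-g2-0`, handover 2026-08-18 (`HOME/pub-hodgecm-cf-gaoullmo-g2/lean/CfGU2/GaoUllmoDictionary.lean`, md5 b7767d72, 462 lines);
landed by the gen-6 packager in gate run 22 as `HodgeCM/Proofs/Pohlmann/GaoUllmoDictionary.lean` (verbatim).
-/
/-
Copyright: pub-hodgecm formalisation cell (harness21, 2026). New file (not vendored).
Seat: literature-prover-pub-hodgecm-cf-gaoullmo-g2-0 (unit pub-hodgecm-cf-gaoullmo-g2, CITED-FACT SEAT (4) Gao–Ullmo, gen 2).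
Suggested place: `HodgeCM/Proofs/Pohlmann/GaoUllmoDictionary.lean` (it imports package vocabulary, so NOT under `Literature/`).
-/
import Summits.HodgeConjecture.HodgeCM.Literature.GaoUllmoTheorem31_3
import Summits.HodgeConjecture.HodgeCM.CM.LefschetzChar_2

/-!
# The dictionary between Gao–Ullmo's condition (3.2) and the package's Hodge weights (KERNEL, no hypothesis)

Gao–Ullmo, *J. Inst. Math. Jussieu* **25** (2025) 215–249 = arXiv:2411.12249, Theorem 3.1 "(Pohlmann)" is typed VERBATIM in
`HodgeCM.Literature.GaoUllmo` (`GaoUllmo.Theorem31`, `GaoUllmo.Theorem31_finrank`) over the paper's own model and PROVED in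
`HodgeCM.Literature.GaoUllmoTheorem31` (`Theorem31_holds`, `Theorem31_finrank_holds`).  The package states Pohlmann's theorem
in PRODUCT form over its geometric universe (`Universe.PohlmannSpan`, `Universe.PohlmannBasis`, `Universe.PohlmannTheorem31`:
`Geometry/WeightVectors.lean`, `Proofs/Pohlmann/PohlmannEq.lean`, `Proofs/Pohlmann/WeightLines.lean`) with the index set
`{S : Fin (n+1) → Finset (Hom(F,ℂ)) // IsHodgeWeight Θ p S}` (`CM/LefschetzChar.lean`), where the Galois condition is phrased with
the group `GalT F` of GALOIS TRANSLATES (permutations of `Hom(F, ℂ)` commuting with `Aut(F)`).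

This file proves, with NO hypothesis beyond `F` Galois over `ℚ` (the range in which `PohlmannSpan` is stated), that the two
index sets are THE SAME: for the CM algebra `E := Fin (n+1) → F` (`GaoUllmo.isCMAlgebra_pi`), the CM type
`Φ_Θ := ⊔_j Θ_j ⊆ Hom(E, ℂ) = ⊔_j Hom(F, ℂ)` and the set `P_S := {(j, s) : s ∈ S_j} ⊆ Hom(E, ℂ)`:

* `galTOf σ : GalT F` — every `σ ∈ Gal(E^c/ℚ)` acts on `Hom(E, ℂ)` through a Galois translate of `Hom(F, ℂ)`
  (`galAct_piEmb`), and for `F` Galois EVERY Galois translate arises this way (`galTOf_surjective`);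
* `isHodgeWeight_iff_satisfiesEq32` — `IsHodgeWeight Θ p S ↔ #P_S = 2p ∧ (3.2) holds for P_S`;
* `hodgeWeightEquiv` — the bijection `{S // IsHodgeWeight Θ p S} ≃ {P ⊆ Hom(E,ℂ), |P| = 2p // (3.2)}` and `card_hodgeWeight_eq`;
* `finrank_Bp_pi_eq_card_hodgeWeight` — with `Theorem31_finrank_holds`: in Gao–Ullmo's model of `A_{(E, Φ_Θ)} = ∏_j A_{(F,Θ_j)}`,
  `dim_ℚ B^p = #{S // IsHodgeWeight Θ p S}` — the same count `Universe.finrank_hodgeClassesOf` (pohl-g3) gives in the package's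
  model (modulo the model facts N1–N4, `p ≥ 1`); `span_Bp_pi_eq_span_wedge_hodgeWeight` — the span form from `Theorem31_holds`.

Nothing is posited: no axiom, no placeholder proof, no `Prop`-valued definition consumed unproved.  The statements bridged
are quoted where they are typed (`GaoUllmo.lean`); the two sentences of the source this dictionary rests on are (verbatim)
"Then the Galois group `G := Gal(E^c/ℚ)` acts on `Hom(E, ℂ) = Φ ⊔ Φ̄`." [Gao–Ullmo §2.1, art. p. 7 = journal p. 221;
corpus:paper:galaxy-pdf-4667137180 chunk p0007 L7; arXiv:2411.12249 chunk p0006 L15] and condition (3.2)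
"`|σP ∩ Φ| = |σP ∩ Φ̄|` for all `σ ∈ G`" [§3.1, art. p. 11; chunk p0012 L5; arXiv chunk p0009 L36].  On the package side the
anchor is the docstring of `HodgeCM.galTranslates` (CM/LefschetzChar.lean): "for `F` Galois these are the maps `σ ↦ τ ∘ σ`,
`τ ∈ Aut(ℂ/ℚ)`" — `galTOf_surjective` below is the kernel form of that remark (with `Gal(E^c/ℚ)` for `Aut(ℂ/ℚ)`).

REMARK (scope).  Without `IsGalois ℚ F` only `satisfiesEq32_of_isHodgeWeight` (Hodge weight ⇒ (3.2)) is proved here; for a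
non-Galois `F` the group `GalT F` can be larger than the image of `Gal(E^c/ℚ)`, so `IsHodgeWeight` is a priori STRONGER than
(3.2).  `Universe.PohlmannSpan` / `PohlmannBasis` / `PohlmannTheorem31` are stated for Galois `F` only, where the two agree.
-/

noncomputable section

open scoped BigOperators

namespace HodgeCM

namespace GaoUllmo

open Literature.AlgebraicGeometry.Motives (CMType)
open HodgeCM.CMTypeOps

attribute [local instance] Classical.propDecidable

section PiDictionary

variable {F : Type} [Field F] {n : ℕ}

/-- The diagonal `F → F^{n+1}` (a ring homomorphism). -/
def piDiag : F →+* (Fin (n + 1) → F) := Pi.constRingHom (Fin (n + 1)) F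

/-- (Ported verbatim from the HodgeCMPerL package; no docstring in the source.) -/
@[simp] theorem piDiag_apply (a : F) (j : Fin (n + 1)) : (piDiag a : Fin (n + 1) → F) j = a := rfl

variable [NumberField F]

/-! ### `Hom(F^{n+1}, ℂ) = ⊔_j Hom(F, ℂ)` -/

/-- The embedding `(j, s) ↦ s ∘ pr_j` of `E = F^{n+1}`. -/
def piEmb (j : Fin (n + 1)) (s : F →+* ℂ) : Emb (Fin (n + 1) → F) :=
  (s.toRatAlgHom).comp (Pi.evalAlgHom ℚ (fun _ : Fin (n + 1) => F) j)

/-- (Ported verbatim from the HodgeCMPerL package; no docstring in the source.) -/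
@[simp] theorem piEmb_apply (j : Fin (n + 1)) (s : F →+* ℂ) (a : Fin (n + 1) → F) :
    piEmb j s a = s (a j) := rfl

/-- (Ported verbatim from the HodgeCMPerL package; no docstring in the source.) -/
theorem piEmb_comp_piDiag (j : Fin (n + 1)) (s : F →+* ℂ) :
    (piEmb j s : (Fin (n + 1) → F) →+* ℂ).comp piDiag = s := by
  ext a; rfl

/-- (Ported verbatim from the HodgeCMPerL package; no docstring in the source.) -/
theorem piEmb_injective : Function.Injective (fun x : Fin (n + 1) × (F →+* ℂ) => piEmb x.1 x.2) := by
  rintro ⟨j, s⟩ ⟨j', s'⟩ h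
  simp only at h
  have hj : j = j' := by
    by_contra hjj
    have h1 := congrArg (fun φ : Emb (Fin (n + 1) → F) => φ (Pi.single j 1)) h
    simp only [piEmb_apply, Pi.single_eq_same, map_one] at h1
    rw [Pi.single_eq_of_ne' hjj, map_zero] at h1
    exact one_ne_zero h1
  subst hj
  have hs : s = s' := by
    have := congrArg (fun φ : Emb (Fin (n + 1) → F) => (φ : (Fin (n + 1) → F) →+* ℂ).comp piDiag) h
    simpa [piEmb_comp_piDiag] using this
  rw [hs]

/-- (Ported verbatim from the HodgeCMPerL package; no docstring in the source.) -/
theorem piEmb_inj {j j' : Fin (n + 1)} {s s' : F →+* ℂ} : piEmb j s = piEmb j' s' ↔ j = j' ∧ s = s' := by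
  constructor
  · intro h
    have := piEmb_injective (n := n) (a₁ := (j, s)) (a₂ := (j', s')) h
    simpa using this
  · rintro ⟨rfl, rfl⟩; rfl

/-- Every embedding of `F^{n+1}` is `s ∘ pr_j` for a unique `(j, s)` (gen 1's `sigmaEmb_surjective`: an algebra homomorphism
out of a finite product of fields is supported on one factor). -/
theorem exists_eq_piEmb (φ : Emb (Fin (n + 1) → F)) : ∃ (j : Fin (n + 1)) (s : F →+* ℂ), φ = piEmb j s := by
  obtain ⟨⟨j, ψ⟩, h⟩ := sigmaEmb_surjective (K := fun _ : Fin (n + 1) => F) (C := ℂ) φ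
  refine ⟨j, (ψ : F →+* ℂ), ?_⟩
  rw [← h]
  apply AlgHom.ext
  intro a
  rfl

/-- `Hom(F^{n+1}, ℂ) ≃ Fin (n+1) × Hom(F, ℂ)`. -/
def piEmbEquiv : (Fin (n + 1) × (F →+* ℂ)) ≃ Emb (Fin (n + 1) → F) :=
  Equiv.ofBijective (fun x => piEmb x.1 x.2)
    ⟨piEmb_injective, fun φ => by
      obtain ⟨j, s, rfl⟩ := exists_eq_piEmb φ
      exact ⟨(j, s), rfl⟩⟩

/-- (Ported verbatim from the HodgeCMPerL package; no docstring in the source.) -/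
@[simp] theorem piEmbEquiv_apply (x : Fin (n + 1) × (F →+* ℂ)) : piEmbEquiv x = piEmb x.1 x.2 := rfl

/-- Complex conjugation commutes with the dictionary. -/
theorem conjEmb_piEmb (j : Fin (n + 1)) (s : F →+* ℂ) :
    conjEmb (piEmb j s) = piEmb j (NumberField.ComplexEmbedding.conjugate s) := by
  apply AlgHom.ext
  intro a
  rw [conjEmb_apply, piEmb_apply, piEmb_apply, NumberField.ComplexEmbedding.conjugate_coe_eq]

/-! ### The set `P_S ⊆ Hom(E, ℂ)` of a weight `S` and the CM type `Φ_Θ = ⊔_j Θ_j` -/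

/-- `P_S := {s ∘ pr_j : s ∈ S_j}`. -/
def embSet (S : Fin (n + 1) → Finset (F →+* ℂ)) : Finset (Emb (Fin (n + 1) → F)) :=
  (Finset.univ.sigma S).image fun x => piEmb x.1 x.2

/-- (Ported verbatim from the HodgeCMPerL package; no docstring in the source.) -/
theorem mem_embSet {S : Fin (n + 1) → Finset (F →+* ℂ)} {j : Fin (n + 1)} {s : F →+* ℂ} :
    piEmb j s ∈ embSet S ↔ s ∈ S j := by
  unfold embSet
  rw [Finset.mem_image]
  constructor
  · rintro ⟨⟨j', s'⟩, hx, h⟩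
    obtain ⟨rfl, rfl⟩ := piEmb_inj.mp h
    simpa using hx
  · intro hs
    exact ⟨⟨j, s⟩, by simpa using hs, rfl⟩

/-- (Ported verbatim from the HodgeCMPerL package; no docstring in the source.) -/
theorem embSet_injOn (S : Fin (n + 1) → Finset (F →+* ℂ)) :
    Set.InjOn (fun x : (Σ _ : Fin (n + 1), (F →+* ℂ)) => piEmb x.1 x.2) ↑(Finset.univ.sigma S) := by
  rintro ⟨j, s⟩ - ⟨j', s'⟩ - h
  obtain ⟨rfl, rfl⟩ := piEmb_inj.mp h
  rfl

/-- (Ported verbatim from the HodgeCMPerL package; no docstring in the source.) -/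
theorem card_embSet (S : Fin (n + 1) → Finset (F →+* ℂ)) : (embSet S).card = ∑ j, (S j).card := by
  unfold embSet
  rw [Finset.card_image_of_injOn (embSet_injOn S), Finset.card_sigma]

/-- The weight read off a subset of `Hom(E, ℂ)`: `S_j := {s : s ∘ pr_j ∈ P}`. -/
def weightOfSet (P : Finset (Emb (Fin (n + 1) → F))) : Fin (n + 1) → Finset (F →+* ℂ) :=
  fun j => Finset.univ.filter fun s => piEmb j s ∈ P

/-- (Ported verbatim from the HodgeCMPerL package; no docstring in the source.) -/
@[simp] theorem mem_weightOfSet {P : Finset (Emb (Fin (n + 1) → F))} {j : Fin (n + 1)} {s : F →+* ℂ} :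
    s ∈ weightOfSet P j ↔ piEmb j s ∈ P := by
  simp [weightOfSet]

/-- (Ported verbatim from the HodgeCMPerL package; no docstring in the source.) -/
theorem weightOfSet_embSet (S : Fin (n + 1) → Finset (F →+* ℂ)) : weightOfSet (embSet S) = S := by
  funext j
  ext s
  rw [mem_weightOfSet, mem_embSet]

/-- (Ported verbatim from the HodgeCMPerL package; no docstring in the source.) -/
theorem embSet_weightOfSet (P : Finset (Emb (Fin (n + 1) → F))) : embSet (weightOfSet P) = P := by
  ext φ
  obtain ⟨j, s, rfl⟩ := exists_eq_piEmb φ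
  rw [mem_embSet, mem_weightOfSet]

/-- `S ↦ P_S` is a bijection between weights and subsets of `Hom(E, ℂ)`. -/
def embSetEquiv : (Fin (n + 1) → Finset (F →+* ℂ)) ≃ Finset (Emb (Fin (n + 1) → F)) where
  toFun := embSet
  invFun := weightOfSet
  left_inv := weightOfSet_embSet
  right_inv := embSet_weightOfSet

/-- The CM type `Φ_Θ := ⊔_j Θ_j` of `E = F^{n+1}` (so that `A_{(E, Φ_Θ)} = ∏_j A_{(F, Θ_j)}`, Gao–Ullmo §2.2). -/
def piCMType (Θ : Fin (n + 1) → CMType F) : CMTypeOn (Fin (n + 1) → F) where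
  Φ := embSet fun j => (Θ j).1.toFinset
  mem_iff := by
    intro φ
    obtain ⟨j, s, rfl⟩ := exists_eq_piEmb φ
    rw [conjEmb_piEmb, mem_embSet, mem_embSet, Set.mem_toFinset, Set.mem_toFinset]
    exact mem_iff_conjugate_notMem (Θ j) s

/-- (Ported verbatim from the HodgeCMPerL package; no docstring in the source.) -/
theorem piEmb_mem_piCMType {Θ : Fin (n + 1) → CMType F} {j : Fin (n + 1)} {s : F →+* ℂ} :
    piEmb j s ∈ (piCMType Θ).Φ ↔ s ∈ (Θ j).1 := by
  unfold piCMType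
  rw [mem_embSet, Set.mem_toFinset]

/-! ### `Gal(E^c/ℚ)` acts on `Hom(E, ℂ) = ⊔_j Hom(F, ℂ)` through Galois translates of `Hom(F, ℂ)` -/

variable (n)

/-- The permutation of `Hom(F, ℂ)` induced by `σ ∈ Gal(E^c/ℚ)`, `E = F^{n+1}`: `s ↦ σ ∘ s` (every `s(F) = (s ∘ pr_j)(E)` lies in `E^c`). -/
def galF (σ : galoisClosure (Fin (n + 1) → F) ≃ₐ[ℚ] galoisClosure (Fin (n + 1) → F)) (s : F →+* ℂ) : F →+* ℂ :=
  (galAct (Fin (n + 1) → F) σ (piEmb 0 s) : (Fin (n + 1) → F) →+* ℂ).comp piDiag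

variable {n}

/-- (Ported verbatim from the HodgeCMPerL package; no docstring in the source.) -/
theorem galF_apply (σ : galoisClosure (Fin (n + 1) → F) ≃ₐ[ℚ] galoisClosure (Fin (n + 1) → F)) (s : F →+* ℂ) (a : F) :
    galF n σ s a = σ (corestrict (Fin (n + 1) → F) (piEmb 0 s) (piDiag a)) := rfl

/-- `σ · (s ∘ pr_j) = (σ · s) ∘ pr_j`. -/
theorem galAct_piEmb (σ : galoisClosure (Fin (n + 1) → F) ≃ₐ[ℚ] galoisClosure (Fin (n + 1) → F))
    (j : Fin (n + 1)) (s : F →+* ℂ) : galAct (Fin (n + 1) → F) σ (piEmb j s) = piEmb j (galF n σ s) := by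
  apply AlgHom.ext
  intro a
  rw [galAct_apply, piEmb_apply, galF_apply]
  congr 1

/-- (Ported verbatim from the HodgeCMPerL package; no docstring in the source.) -/
theorem galF_injective (σ : galoisClosure (Fin (n + 1) → F) ≃ₐ[ℚ] galoisClosure (Fin (n + 1) → F)) :
    Function.Injective (galF n σ) := by
  intro s s' h
  have := galAct_injective (E := Fin (n + 1) → F) σ
    (a₁ := piEmb 0 s) (a₂ := piEmb 0 s') (by rw [galAct_piEmb, galAct_piEmb, h])
  exact (piEmb_inj.mp this).2

/-- The Galois translate of `Hom(F, ℂ)` defined by `σ ∈ Gal(E^c/ℚ)`. -/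
def galTOf (σ : galoisClosure (Fin (n + 1) → F) ≃ₐ[ℚ] galoisClosure (Fin (n + 1) → F)) : GalT F :=
  ⟨Equiv.ofBijective (galF n σ) ((Finite.injective_iff_bijective).mp (galF_injective σ)), by
    intro s g
    show galF n σ (s.comp (g : F →+* F)) = (galF n σ s).comp (g : F →+* F)
    ext a
    rw [galF_apply, RingHom.comp_apply, galF_apply]
    congr 1⟩

/-- (Ported verbatim from the HodgeCMPerL package; no docstring in the source.) -/
@[simp] theorem galTOf_apply (σ : galoisClosure (Fin (n + 1) → F) ≃ₐ[ℚ] galoisClosure (Fin (n + 1) → F)) (s : F →+* ℂ) :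
    (galTOf σ).1 s = galF n σ s := rfl


/-! ### For `F` Galois, EVERY Galois translate of `Hom(F, ℂ)` comes from `Gal(E^c/ℚ)` -/

section Galois

/-- (Ported verbatim from the HodgeCMPerL package; no docstring in the source.) -/
theorem apply_mem_galoisClosure (σ₀ : F →+* ℂ) (a : F) : σ₀ a ∈ galoisClosure (Fin (n + 1) → F) :=
  range_subset_galoisClosure _ (piEmb 0 σ₀) ⟨piDiag a, rfl⟩

/-- (Ported verbatim from the HodgeCMPerL package; no docstring in the source.) -/
theorem galF_autOfEmb_apply (ρ : galoisClosure (Fin (n + 1) → F) →ₐ[ℚ] ℂ) (s : F →+* ℂ) (a : F) :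
    galF n (autOfEmb ρ) s a = ρ (corestrict (Fin (n + 1) → F) (piEmb 0 s) (piDiag a)) := by
  show (galAct (Fin (n + 1) → F) (autOfEmb ρ) (piEmb 0 s)) (piDiag a) = _
  rw [galAct_autOfEmb, embAct_apply]

variable [IsGalois ℚ F]

/-- (Ported verbatim from the HodgeCMPerL package; no docstring in the source.) -/
theorem range_subset_range_of_isGalois (σ₀ s : F →+* ℂ) : Set.range s ⊆ Set.range σ₀ := by
  obtain ⟨g, rfl⟩ := exists_aut_eq σ₀ s
  rintro _ ⟨a, rfl⟩
  exact ⟨g a, rfl⟩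

/-- For `F` Galois, `E^c = σ₀(F)` for any one embedding `σ₀` (`E = F^{n+1}`): the inclusion `E^c ⊆ σ₀(F)`. -/
theorem galoisClosure_pi_subset_range (σ₀ : F →+* ℂ) :
    ((galoisClosure (Fin (n + 1) → F) : IntermediateField ℚ ℂ) : Set ℂ) ⊆ Set.range σ₀ := by
  have h : galoisClosure (Fin (n + 1) → F) ≤ (σ₀.toRatAlgHom).fieldRange := by
    unfold galoisClosure
    rw [IntermediateField.adjoin_le_iff]
    intro z hz
    obtain ⟨φ, ⟨a, rfl⟩⟩ := Set.mem_iUnion.mp hz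
    obtain ⟨j, s, rfl⟩ := exists_eq_piEmb φ
    obtain ⟨b, hb⟩ := range_subset_range_of_isGalois σ₀ s ⟨a j, rfl⟩
    rw [SetLike.mem_coe, AlgHom.mem_fieldRange]
    exact ⟨b, by rw [piEmb_apply, ← hb]; rfl⟩
  intro z hz
  obtain ⟨b, hb⟩ := (AlgHom.mem_fieldRange.mp (h hz))
  exact ⟨b, hb⟩

variable (n)

/-- `F ≃ E^c`, `a ↦ σ₀(a)` (`F` Galois, `E = F^{n+1}`). -/
def equivClosure (σ₀ : F →+* ℂ) : F ≃ₐ[ℚ] galoisClosure (Fin (n + 1) → F) :=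
  AlgEquiv.ofBijective
    (AlgHom.codRestrict σ₀.toRatAlgHom (galoisClosure (Fin (n + 1) → F)).toSubalgebra
      (fun a => apply_mem_galoisClosure σ₀ a))
    ⟨fun a b h => σ₀.injective (congrArg Subtype.val h :), fun x => by
      obtain ⟨a, ha⟩ := galoisClosure_pi_subset_range (n := n) σ₀ x.2
      exact ⟨a, Subtype.ext ha⟩⟩

/-- (Ported verbatim from the HodgeCMPerL package; no docstring in the source.) -/
@[simp] theorem coe_equivClosure_apply (σ₀ : F →+* ℂ) (a : F) : (equivClosure n σ₀ a : ℂ) = σ₀ a := rfl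

/-- The embedding `E^c → ℂ` transporting `h ∈ Aut(F)`: `σ₀(a) ↦ σ₀(h a)`. -/
def closureEmbOfAut (σ₀ : F →+* ℂ) (h : F ≃ₐ[ℚ] F) : galoisClosure (Fin (n + 1) → F) →ₐ[ℚ] ℂ :=
  (σ₀.toRatAlgHom.comp (h : F →ₐ[ℚ] F)).comp (equivClosure n σ₀).symm.toAlgHom

/-- (Ported verbatim from the HodgeCMPerL package; no docstring in the source.) -/
theorem closureEmbOfAut_apply_equivClosure (σ₀ : F →+* ℂ) (h : F ≃ₐ[ℚ] F) (a : F) :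
    closureEmbOfAut n σ₀ h (equivClosure n σ₀ a) = σ₀ (h a) := by
  simp [closureEmbOfAut]

variable {n}

/-- `σ_h · σ₀ = σ₀ ∘ h` for `σ_h := autOfEmb (closureEmbOfAut σ₀ h)`. -/
theorem galF_autOfEmb_closureEmbOfAut (σ₀ : F →+* ℂ) (h : F ≃ₐ[ℚ] F) :
    galF n (autOfEmb (closureEmbOfAut n σ₀ h)) σ₀ = σ₀.comp (h : F →+* F) := by
  ext a
  rw [galF_autOfEmb_apply, RingHom.comp_apply]
  have : corestrict (Fin (n + 1) → F) (piEmb 0 σ₀) (piDiag a) = equivClosure n σ₀ a := Subtype.ext rfl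
  rw [this, closureEmbOfAut_apply_equivClosure]
  rfl

/-- For `F` Galois every Galois translate of `Hom(F, ℂ)` is induced by an element of `Gal(E^c/ℚ)`. -/
theorem galTOf_surjective : Function.Surjective (galTOf (F := F) (n := n)) := by
  intro P
  obtain ⟨σ₀⟩ : Nonempty (F →+* ℂ) := inferInstance
  obtain ⟨h, hh⟩ := exists_aut_eq σ₀ (P.1 σ₀)
  refine ⟨autOfEmb (closureEmbOfAut n σ₀ h), GalT.ext_of_apply σ₀ ?_⟩
  rw [galTOf_apply, galF_autOfEmb_closureEmbOfAut, hh]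

end Galois

/-! ### Counting: `|σ P_S ∩ Φ_Θ|` is the package's count `#{(j,s) ∈ S : (σ·s) ∈ Θ_j}` -/

section Count

/-- `#{(j, s) : s ∈ S_j, P s ∈ Θ_j}` for a permutation `P` of `Hom(F, ℂ)`. -/
def typeCount (Θ : Fin (n + 1) → CMType F) (S : Fin (n + 1) → Finset (F →+* ℂ)) (P : (F →+* ℂ) → (F →+* ℂ)) : ℕ :=
  ((Finset.univ.sigma S).filter fun x => P x.2 ∈ (Θ x.1).1).card

omit [NumberField F] in
/-- (Ported verbatim from the HodgeCMPerL package; no docstring in the source.) -/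
theorem sum_ind_eq_typeCount (Θ : Fin (n + 1) → CMType F) (S : Fin (n + 1) → Finset (F →+* ℂ))
    (P : (F →+* ℂ) → (F →+* ℂ)) :
    (∑ j, ∑ s ∈ S j, ind (Θ j) (P s)) = (typeCount Θ S P : ℤ) := by
  unfold typeCount
  rw [Finset.natCast_card_filter, Finset.sum_sigma]
  refine Finset.sum_congr rfl fun j _ => Finset.sum_congr rfl fun s _ => ?_
  unfold ind
  congr 1

/-- (Ported verbatim from the HodgeCMPerL package; no docstring in the source.) -/
theorem galActSet_embSet (σ : galoisClosure (Fin (n + 1) → F) ≃ₐ[ℚ] galoisClosure (Fin (n + 1) → F))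
    (S : Fin (n + 1) → Finset (F →+* ℂ)) :
    galActSet (Fin (n + 1) → F) σ (embSet S) =
      (Finset.univ.sigma S).image fun x => piEmb x.1 (galF n σ x.2) := by
  unfold galActSet embSet
  rw [Finset.image_image]
  apply Finset.image_congr
  intro x _
  exact galAct_piEmb σ x.1 x.2

/-- (Ported verbatim from the HodgeCMPerL package; no docstring in the source.) -/
theorem card_galActSet_embSet_inter (σ : galoisClosure (Fin (n + 1) → F) ≃ₐ[ℚ] galoisClosure (Fin (n + 1) → F))
    (Θ : Fin (n + 1) → CMType F) (S : Fin (n + 1) → Finset (F →+* ℂ)) :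
    (galActSet (Fin (n + 1) → F) σ (embSet S) ∩ (piCMType Θ).Φ).card = typeCount Θ S (galF n σ) := by
  rw [galActSet_embSet, ← Finset.filter_mem_eq_inter, Finset.filter_image]
  have hinj : Set.InjOn (fun x : (Σ _ : Fin (n + 1), (F →+* ℂ)) => piEmb x.1 (galF n σ x.2))
      ↑((Finset.univ.sigma S).filter fun x => piEmb x.1 (galF n σ x.2) ∈ (piCMType Θ).Φ) := by
    rintro ⟨j, s⟩ - ⟨j', s'⟩ - h
    obtain ⟨rfl, hs⟩ := piEmb_inj.mp h
    obtain rfl := galF_injective σ hs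
    rfl
  rw [Finset.card_image_of_injOn hinj]
  unfold typeCount
  congr 1
  apply Finset.filter_congr
  intro x _
  exact piEmb_mem_piCMType


-- port_pkg: scope closed for this part
end Count
end PiDictionary
end GaoUllmo
end HodgeCM
end
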